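import Summits.SmoothPoincare4.SmoothPoincare4.Theorems.SullivanDualWitnessChargeDefs
import Summits.SmoothPoincare4.SmoothPoincare4.Theorems.SullivanDualWitnessChargeFlatChart
import Mathlib.Analysis.Convex.Topology
import Mathlib.Analysis.Complex.Convex
import Mathlib.Topology.MetricSpace.Pseudo.Lemmas

/-!
# One step of the continuity method (STEP)

Crux `WitnessCharge` (stmt-SmoothPoincare4-7824), line `Sketch`, skeleton v7, stub `helper_continuityStep`.

One step of the continuity method for Gromov's pencil of `J`-planes on `Σ ∖ p`, run over the
half-planes `H_s = {s < re b}` of intercepts: a family of members over `H_s` (members, `C^∞` in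
`(b, ξ)`, injective differential) extends to a family over `H_{s-η}` for some `η > 0`, unless
`CurveAway`. The four analytic inputs are hypotheses of the statement (far family FARFAM, far
rigidity FARU, uniqueness UNIQ, frontier extension EXT); the proof here is topology and bookkeeping:

* **far agreement** (`farAgree`): by FARU two members of the same far intercept `‖b‖ > ε'⁻¹` have
  the same flat coordinates `(ξ, b)` inside the punctured `ε'`-chart-ball, where `Ycoord p` is
  injective (`substub_flatChart`), so they are equal;
* **EXT discs and a Lebesgue number**: by EXT (the `CurveAway` branch being excluded) every point
  `c` of the closed half-plane `{s ≤ re b} = closure H_s` carries a disc `ball c (δ c)` with a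
  family `F' c` agreeing with `F` on `H_s ∩ ball c (δ c)`; the compact frontier segment
  `K = {re b = s, |im b| ≤ ε'⁻¹ + 1}` has a Lebesgue number `η₀` for these discs, and for every
  `x ∈ K` we choose a centre `ctr x ∈ K` with `ball x η₀ ⊆ ball (ctr x) (δ (ctr x))`;
* **the glued map** over `H_{s-η₀}`: `F` on `H_s`; on `{re b ≤ s, |im b| ≤ ε'⁻¹ + 1}`
  the EXT family of the centre chosen for the foot `(s, im b) ∈ K` of `b` (which is `η₀`-close to
  `b`); the far family on `{re b ≤ s, |im b| > ε'⁻¹ + 1}`;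
* **local agreement** with ONE honest family near every point (so that membership, smoothness and
  injectivity of the differential, all local in the intercept, transfer: `famOn_of_locally`): with
  `F` on the open `H_s`; with the far family on the open far region `{|im b| > ε'⁻¹ + 1}` (far
  agreement); with the EXT family `F' c₀` of the centre of `b₀` on `ball c₀ (δ c₀) ∩ H_{s-η₀}` —
  there the glued map is `F = F' c₀` (EXT agreement), or `F' c = F' c₀` by UNIQ on the intersection
  of two discs centred on the line `re = s` (open, convex, and containing a point of `H_s` where
  both equal `F`: `exists_mem_inter_ball_lt_re`, `extAgree`), or the far family `= F' c₀` (far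
  agreement).

References: M. Gromov, *Pseudo holomorphic curves in symplectic manifolds*, Invent. Math. 82
(1985), §2.4.A [Gromov1985] (the pencil of `J`-planes and its completeness by continuity).
-/

noncomputable section

set_option linter.dupNamespace false

open scoped Manifold ContDiff Topology
open Set Filter Literature.Geometry.Kaehler Literature.Geometry.Symplectic
  Literature.Topology.FourManifolds

namespace Summit.SmoothPoincare4.SmoothPoincare4.Theorems.WitnessCharge.PencilIncompleteness

variable {S : HomotopySphere 4} {p : S.carrier}

/-- `FamOn[J, X, G]`: `G` is a family of pencil members over the set `X` of intercepts — purely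
syntactic local shorthand for the three written-out clauses of the registered statements
(members; `(b, ξ) ↦ G b ξ` of class `C^∞` on `X × ℂ`; injective differential there). -/
local notation3 (prettyPrint := false) "FamOn[" J ", " X ", " G "]" =>
  ((∀ b ∈ X, IsPencilMember J (G b) b) ∧
    ContMDiffOn 𝓘(ℝ, ℂ × ℂ) (𝓡 4) ∞ (fun q : ℂ × ℂ => G q.1 q.2) ((X) ×ˢ (univ : Set ℂ)) ∧
    (∀ q : ℂ × ℂ, q.1 ∈ X →
      Function.Injective (mfderiv 𝓘(ℝ, ℂ × ℂ) (𝓡 4) (fun q : ℂ × ℂ => G q.1 q.2) q)))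

/-! ### Plane geometry along the frontier line `re b = s` -/

/-- A point of the strip `s - η < re b ≤ s` is `η`-close to its foot `(s, im b)` on the line. -/
theorem mem_ball_foot {s η : ℝ} {b : ℂ} (h₁ : s - η < b.re) (h₂ : b.re ≤ s) :
    b ∈ Metric.ball (⟨s, b.im⟩ : ℂ) η := by
  rw [Metric.mem_ball, Complex.dist_of_im_eq (z := b) (w := ⟨s, b.im⟩) rfl]
  show dist b.re s < η
  rw [Real.dist_eq, abs_sub_lt_iff]
  constructor <;> linarith

/-- The foot `(s, im b)` of `b` on the line `re = s` is at least as close as `b` to every point of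
that line. -/
theorem dist_foot_le {s : ℝ} {c : ℂ} (hc : c.re = s) (b : ℂ) :
    dist (⟨s, b.im⟩ : ℂ) c ≤ dist b c := by
  rw [Complex.dist_of_re_eq (z := ⟨s, b.im⟩) (w := c) hc.symm]
  show dist b.im c.im ≤ dist b c
  rw [Real.dist_eq, ← Complex.sub_im, dist_eq_norm]
  exact Complex.abs_im_le_norm _

/-- Two discs centred on the line `re = s` with a common point have a common point strictly to the
right of the line (the foot of the common point lies in both discs, which are open). -/
theorem exists_mem_inter_ball_lt_re {s : ℝ} {c₁ c₂ b : ℂ} {r₁ r₂ : ℝ} (hc₁ : c₁.re = s)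
    (hc₂ : c₂.re = s) (hb₁ : b ∈ Metric.ball c₁ r₁) (hb₂ : b ∈ Metric.ball c₂ r₂) :
    ∃ b₁ ∈ Metric.ball c₁ r₁ ∩ Metric.ball c₂ r₂, s < b₁.re := by
  have hm : (⟨s, b.im⟩ : ℂ) ∈ Metric.ball c₁ r₁ ∩ Metric.ball c₂ r₂ :=
    ⟨(dist_foot_le hc₁ b).trans_lt hb₁, (dist_foot_le hc₂ b).trans_lt hb₂⟩
  obtain ⟨r, hr, hrD⟩ :=
    Metric.isOpen_iff.1 (Metric.isOpen_ball.inter Metric.isOpen_ball) _ hm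
  refine ⟨⟨s, b.im⟩ + ((r / 2 : ℝ) : ℂ), hrD ?_, ?_⟩
  · rw [Metric.mem_ball,
      Complex.dist_of_im_eq (z := ⟨s, b.im⟩ + ((r / 2 : ℝ) : ℂ)) (w := ⟨s, b.im⟩) (by simp)]
    show dist (s + r / 2) s < r
    rw [Real.dist_eq, abs_lt]
    constructor <;> linarith
  · show s < s + r / 2
    linarith

/-! ### Gluing families along open pieces -/

/-- Near a point `q = (b, ξ)`, two maps `(b, ξ) ↦ G b ξ`, `(b, ξ) ↦ G₀ b ξ` which agree for `b` in a
neighbourhood `N` of `q.1` agree on the neighbourhood `N × ℂ` of `q`. -/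
theorem eventuallyEq_of_agree {Y : Type*} {N : Set ℂ} {G G₀ : ℂ → ℂ → Y} {q : ℂ × ℂ}
    (hN : N ∈ 𝓝 q.1) (hagree : ∀ b ∈ N, G b = G₀ b) :
    N ×ˢ (univ : Set ℂ) ∈ 𝓝 q ∧
      (fun q : ℂ × ℂ => G q.1 q.2) =ᶠ[𝓝 q] fun q : ℂ × ℂ => G₀ q.1 q.2 := by
  have hNq : N ×ˢ (univ : Set ℂ) ∈ 𝓝 q := prod_mem_nhds hN univ_mem
  exact ⟨hNq, eventuallyEq_of_mem hNq fun q' hq' => congrFun (hagree q'.1 hq'.1) q'.2⟩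

/-- GLUING: the three clauses of a family (membership, smoothness of `(b, ξ) ↦ G b ξ`, injectivity
of the differential) are local in the intercept — if near every `b₀ ∈ U` the map `G` agrees with
some family `G₀` (over an auxiliary set `V`) on a neighbourhood `N ⊆ V` of `b₀`, then `G` is a
family over `U`. -/
theorem famOn_of_locally
    {J : ∀ x : punctured p, TangentSpace (𝓡 4) x →L[ℝ] TangentSpace (𝓡 4) x}
    {U : Set ℂ} {G : ℂ → ℂ → punctured p}
    (h : ∀ b₀ ∈ U, ∃ N ∈ 𝓝 b₀, ∃ (G₀ : ℂ → ℂ → punctured p) (V : Set ℂ),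
      N ⊆ V ∧ FamOn[J, V, G₀] ∧ ∀ b ∈ N, G b = G₀ b) :
    FamOn[J, U, G] := by
  refine ⟨fun b hb => ?_, fun q hq => ?_, fun q hq => ?_⟩
  · obtain ⟨N, hN, G₀, V, hNV, ⟨hmem, -, -⟩, hagree⟩ := h b hb
    rw [hagree b (mem_of_mem_nhds hN)]
    exact hmem b (hNV (mem_of_mem_nhds hN))
  · obtain ⟨N, hN, G₀, V, hNV, ⟨-, hsmooth, -⟩, hagree⟩ := h q.1 hq.1
    obtain ⟨hNq, heq⟩ := eventuallyEq_of_agree hN hagree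
    have hVq : V ×ˢ (univ : Set ℂ) ∈ 𝓝 q := mem_of_superset hNq (prod_mono hNV Subset.rfl)
    exact ((hsmooth.contMDiffAt hVq).congr_of_eventuallyEq heq).contMDiffWithinAt
  · obtain ⟨N, hN, G₀, V, hNV, ⟨-, -, hinj⟩, hagree⟩ := h q.1 hq
    obtain ⟨-, heq⟩ := eventuallyEq_of_agree hN hagree
    rw [heq.mfderiv_eq]
    exact hinj q (hNV (mem_of_mem_nhds hN))

/-! ### Agreement of the pieces -/

section Agreement

variable {J : ∀ x : punctured p, TangentSpace (𝓡 4) x →L[ℝ] TangentSpace (𝓡 4) x} {ε' : ℝ}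

/-- FAR AGREEMENT: when every member of far intercept is the far flat line (hypothesis `hFar`, the
landed FARU), two members of the same far intercept coincide — their flat coordinates agree inside
the punctured `ε'`-chart-ball, where `Ycoord p` is injective (`substub_flatChart`). -/
theorem farAgree (hε' : 0 < ε')
    (hball : Metric.closedBall (extChartAt (𝓡 4) p p) ε' ⊆ (extChartAt (𝓡 4) p).target)
    (hFar : ∀ (u : ℂ → punctured p) (b : ℂ), IsPencilMember J u b → ε'⁻¹ < ‖b‖ →
      ∀ ξ : ℂ, InPuncturedChartBall p ε' (u ξ) ∧ Ycoord p (u ξ) = (ξ, b))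
    {u u' : ℂ → punctured p} {b : ℂ} (hu : IsPencilMember J u b) (hu' : IsPencilMember J u' b)
    (hb : ε'⁻¹ < ‖b‖) : u = u' := by
  obtain ⟨Φ, hsrc, -, hΦY, -⟩ := substub_flatChart S p ε' hε' hball
  funext ξ
  obtain ⟨hin, hY⟩ := hFar u b hu hb ξ
  obtain ⟨hin', hY'⟩ := hFar u' b hu' hb ξ
  refine Φ.injOn (show u ξ ∈ Φ.source by rw [hsrc]; exact hin)
    (show u' ξ ∈ Φ.source by rw [hsrc]; exact hin') ?_
  rw [hΦY, hΦY, hY, hY']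

/-- EXT AGREEMENT: two families over discs centred on the line `re = s`, both agreeing with `F` on
the parts of their discs in `{s < re b}`, agree on the intersection of the discs — by UNIQ
(hypothesis `hUniq`) on this open convex set, which contains a point of `{s < re b}`
(`exists_mem_inter_ball_lt_re`) where both families equal `F`. -/
theorem extAgree
    (hUniq : ∀ (D : Set ℂ) (F₁ F₂ : ℂ → ℂ → punctured p), IsOpen D → IsPreconnected D →
      (∀ b ∈ D, IsPencilMember J (F₁ b) b) → (∀ b ∈ D, IsPencilMember J (F₂ b) b) →
      ContinuousOn (fun q : ℂ × ℂ => F₁ q.1 q.2) (D ×ˢ (univ : Set ℂ)) →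
      ContinuousOn (fun q : ℂ × ℂ => F₂ q.1 q.2) (D ×ˢ (univ : Set ℂ)) →
      (∃ b₀ ∈ D, F₁ b₀ = F₂ b₀) → ∀ b ∈ D, F₁ b = F₂ b)
    {s : ℝ} {F G₁ G₂ : ℂ → ℂ → punctured p} {c₁ c₂ : ℂ} {r₁ r₂ : ℝ}
    (hc₁ : c₁.re = s) (hc₂ : c₂.re = s)
    (hG₁ : FamOn[J, Metric.ball c₁ r₁, G₁]) (hG₂ : FamOn[J, Metric.ball c₂ r₂, G₂])
    (ha₁ : ∀ b ∈ {b : ℂ | s < b.re} ∩ Metric.ball c₁ r₁, G₁ b = F b)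
    (ha₂ : ∀ b ∈ {b : ℂ | s < b.re} ∩ Metric.ball c₂ r₂, G₂ b = F b) :
    ∀ b ∈ Metric.ball c₁ r₁ ∩ Metric.ball c₂ r₂, G₁ b = G₂ b := by
  rintro b ⟨hb₁, hb₂⟩
  obtain ⟨b₁, ⟨hb₁₁, hb₁₂⟩, hb₁re⟩ := exists_mem_inter_ball_lt_re hc₁ hc₂ hb₁ hb₂
  exact hUniq (Metric.ball c₁ r₁ ∩ Metric.ball c₂ r₂) G₁ G₂
    (Metric.isOpen_ball.inter Metric.isOpen_ball)
    ((convex_ball c₁ r₁).inter (convex_ball c₂ r₂)).isPreconnected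
    (fun b hb => hG₁.1 b hb.1) (fun b hb => hG₂.1 b hb.2)
    (hG₁.2.1.continuousOn.mono (prod_mono inter_subset_left Subset.rfl))
    (hG₂.2.1.continuousOn.mono (prod_mono inter_subset_right Subset.rfl))
    ⟨b₁, ⟨hb₁₁, hb₁₂⟩, by rw [ha₁ b₁ ⟨hb₁re, hb₁₁⟩, ha₂ b₁ ⟨hb₁re, hb₁₂⟩]⟩ b ⟨hb₁, hb₂⟩

end Agreement

/-- **STEP — one step of the continuity method over half-planes** (from FARFAM `hFarFam`, FARU
`hFar`, UNIQ `hUniq`, EXT `hExt`, all hypotheses): a family of pencil members over `{s < re b}`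
(`C^∞` in `(b, ξ)`, injective differential) extends to a family over `{s - η < re b}` for some
`η > 0`, unless `CurveAway`. Proof: exclude `CurveAway`; EXT then gives a disc with an extending
family at every point of `{s ≤ re b}`; take a Lebesgue number `η₀` of these discs on the compact
segment `K = {re b = s, |im b| ≤ ε'⁻¹ + 1}` and a centre map `ctr : K → K`; glue `F` on
`{s < re b}`, the EXT family of `ctr (s, im b)` on `{re b ≤ s, |im b| ≤ ε'⁻¹ + 1}`, the far family
elsewhere; the glued map agrees near every point of `{s - η₀ < re b}` with one honest family
(`F`; the far family, by `farAgree`; an EXT family, by EXT agreement, `extAgree` and `farAgree`),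
hence is a family (`famOn_of_locally`). -/
theorem helper_continuityStep :
    ∀ (S : HomotopySphere 4) (p : S.carrier)
      (J : ∀ x : punctured p, TangentSpace (𝓡 4) x →L[ℝ] TangentSpace (𝓡 4) x) (ε' : ℝ),
      0 < ε' →
      Metric.closedBall (extChartAt (𝓡 4) p p) ε' ⊆ (extChartAt (𝓡 4) p).target →
      (∀ x : punctured p, InPuncturedChartBall p ε' x →
        ∀ (v : TangentSpace (𝓡 4) x) (b : EuclideanSpace ℝ (Fin 4)),
          inner ℝ (fderiv ℝ inversion (extChartAt (𝓡 4) p x.1 - extChartAt (𝓡 4) p p)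
            (mfderiv (𝓡 4) 𝓘(ℝ, EuclideanSpace ℝ (Fin 4))
              (fun z : punctured p => extChartAt (𝓡 4) p z.1) x (J x v))) b
          = stdSymplecticForm (fderiv ℝ inversion (extChartAt (𝓡 4) p x.1 - extChartAt (𝓡 4) p p)
            (mfderiv (𝓡 4) 𝓘(ℝ, EuclideanSpace ℝ (Fin 4))
              (fun z : punctured p => extChartAt (𝓡 4) p z.1) x v)) b) →
      (∃ F : ℂ → ℂ → punctured p,
          ((∀ b ∈ {b : ℂ | ε'⁻¹ < ‖b‖}, IsPencilMember J (F b) b) ∧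
            ContMDiffOn 𝓘(ℝ, ℂ × ℂ) (𝓡 4) ∞ (fun q : ℂ × ℂ => F q.1 q.2) (({b : ℂ | ε'⁻¹ < ‖b‖}) ×ˢ (univ : Set ℂ)) ∧
            (∀ q : ℂ × ℂ, q.1 ∈ {b : ℂ | ε'⁻¹ < ‖b‖} →
              Function.Injective (mfderiv 𝓘(ℝ, ℂ × ℂ) (𝓡 4) (fun q : ℂ × ℂ => F q.1 q.2) q)))) →
      (∀ (u : ℂ → punctured p) (b : ℂ), IsPencilMember J u b → ε'⁻¹ < ‖b‖ →
        ∀ ξ : ℂ, InPuncturedChartBall p ε' (u ξ) ∧ Ycoord p (u ξ) = (ξ, b)) →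
      (∀ (D : Set ℂ) (F₁ F₂ : ℂ → ℂ → punctured p), IsOpen D → IsPreconnected D →
        (∀ b ∈ D, IsPencilMember J (F₁ b) b) → (∀ b ∈ D, IsPencilMember J (F₂ b) b) →
        ContinuousOn (fun q : ℂ × ℂ => F₁ q.1 q.2) (D ×ˢ (univ : Set ℂ)) →
        ContinuousOn (fun q : ℂ × ℂ => F₂ q.1 q.2) (D ×ˢ (univ : Set ℂ)) →
        (∃ b₀ ∈ D, F₁ b₀ = F₂ b₀) → ∀ b ∈ D, F₁ b = F₂ b) →
      (∀ (D : Set ℂ) (F : ℂ → ℂ → punctured p) (bstar : ℂ), IsOpen D → Convex ℝ D →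
        ((∀ b ∈ D, IsPencilMember J (F b) b) ∧
          ContMDiffOn 𝓘(ℝ, ℂ × ℂ) (𝓡 4) ∞ (fun q : ℂ × ℂ => F q.1 q.2) ((D) ×ˢ (univ : Set ℂ)) ∧
          (∀ q : ℂ × ℂ, q.1 ∈ D →
            Function.Injective (mfderiv 𝓘(ℝ, ℂ × ℂ) (𝓡 4) (fun q : ℂ × ℂ => F q.1 q.2) q))) →
        bstar ∈ closure D →
        CurveAway S p J ∨ ∃ δ : ℝ, 0 < δ ∧ ∃ F' : ℂ → ℂ → punctured p,
          ((∀ b ∈ Metric.ball bstar δ, IsPencilMember J (F' b) b) ∧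
            ContMDiffOn 𝓘(ℝ, ℂ × ℂ) (𝓡 4) ∞ (fun q : ℂ × ℂ => F' q.1 q.2) ((Metric.ball bstar δ) ×ˢ (univ : Set ℂ)) ∧
            (∀ q : ℂ × ℂ, q.1 ∈ Metric.ball bstar δ →
              Function.Injective (mfderiv 𝓘(ℝ, ℂ × ℂ) (𝓡 4) (fun q : ℂ × ℂ => F' q.1 q.2) q))) ∧
          ∀ b ∈ D ∩ Metric.ball bstar δ, F' b = F b) →
      ∀ (s : ℝ) (F : ℂ → ℂ → punctured p),
        ((∀ b ∈ {b : ℂ | s < b.re}, IsPencilMember J (F b) b) ∧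
          ContMDiffOn 𝓘(ℝ, ℂ × ℂ) (𝓡 4) ∞ (fun q : ℂ × ℂ => F q.1 q.2) (({b : ℂ | s < b.re}) ×ˢ (univ : Set ℂ)) ∧
          (∀ q : ℂ × ℂ, q.1 ∈ {b : ℂ | s < b.re} →
            Function.Injective (mfderiv 𝓘(ℝ, ℂ × ℂ) (𝓡 4) (fun q : ℂ × ℂ => F q.1 q.2) q))) →
        CurveAway S p J ∨ ∃ η : ℝ, 0 < η ∧ ∃ F' : ℂ → ℂ → punctured p,
          ((∀ b ∈ {b : ℂ | s - η < b.re}, IsPencilMember J (F' b) b) ∧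
            ContMDiffOn 𝓘(ℝ, ℂ × ℂ) (𝓡 4) ∞ (fun q : ℂ × ℂ => F' q.1 q.2) (({b : ℂ | s - η < b.re}) ×ˢ (univ : Set ℂ)) ∧
            (∀ q : ℂ × ℂ, q.1 ∈ {b : ℂ | s - η < b.re} →
              Function.Injective (mfderiv 𝓘(ℝ, ℂ × ℂ) (𝓡 4) (fun q : ℂ × ℂ => F' q.1 q.2) q))) := by
  intro S p J ε' hε' hball _hJstd hFarFam hFar hUniq hExt s F hF
  classical
  by_cases hcurve : CurveAway S p J
  · exact Or.inl hcurve
  refine Or.inr ?_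
  obtain ⟨Ffar, hFfar⟩ := hFarFam
  have hHopen : IsOpen {b : ℂ | s < b.re} := isOpen_lt continuous_const Complex.continuous_re
  -- far intercepts: `|im b| > ε'⁻¹ + 1` forces `‖b‖ > ε'⁻¹`
  have hfar_of_im : ∀ b : ℂ, ε'⁻¹ + 1 < |b.im| → ε'⁻¹ < ‖b‖ := fun b hb => by
    linarith [Complex.abs_im_le_norm b]
  -- EXT at every point of the closed half-plane `{s ≤ re b} = closure {s < re b}` (junk elsewhere)
  have hext : ∀ c : ℂ, ∃ (r : ℝ) (G : ℂ → ℂ → punctured p), s ≤ c.re →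
      0 < r ∧ FamOn[J, Metric.ball c r, G] ∧
        ∀ b ∈ {b : ℂ | s < b.re} ∩ Metric.ball c r, G b = F b := by
    intro c
    by_cases hc : s ≤ c.re
    · have hcl : c ∈ closure {b : ℂ | s < b.re} := by
        rw [Complex.closure_setOf_lt_re]
        exact hc
      obtain ⟨r, hr, G, hG, hagree⟩ :=
        (hExt _ F c hHopen (convex_halfSpace_re_gt s) hF hcl).resolve_left hcurve
      exact ⟨r, G, fun _ => ⟨hr, hG, hagree⟩⟩
    · exact ⟨1, F, fun h => absurd h hc⟩
  choose δ F' hδF' using hext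
  -- the compact frontier segment and a Lebesgue number of its cover by the EXT discs
  set K : Set ℂ := {b : ℂ | b.re = s ∧ |b.im| ≤ ε'⁻¹ + 1}
  have hKre : ∀ b ∈ K, s ≤ b.re := fun b hb => hb.1.symm.le
  have hKc : IsCompact K := by
    refine Metric.isCompact_of_isClosed_isBounded
      ((isClosed_eq Complex.continuous_re continuous_const).inter
        (isClosed_le (continuous_abs.comp Complex.continuous_im) continuous_const)) ?_
    refine (Metric.isBounded_closedBall (x := (⟨s, 0⟩ : ℂ)) (r := ε'⁻¹ + 1)).subset ?_
    rintro b ⟨hre, him⟩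
    rw [Metric.mem_closedBall, Complex.dist_of_re_eq (z := b) (w := ⟨s, 0⟩) hre]
    show dist b.im 0 ≤ ε'⁻¹ + 1
    rwa [Real.dist_eq, sub_zero]
  obtain ⟨η₀, hη₀, hleb⟩ := lebesgue_number_lemma_of_metric (ι := K)
    (c := fun i => Metric.ball i.1 (δ i.1)) hKc (fun _ => Metric.isOpen_ball)
    (fun b hb => mem_iUnion.2 ⟨⟨b, hb⟩, Metric.mem_ball_self (hδF' b (hKre b hb)).1⟩)
  -- a centre map: `ball x η₀ ⊆ ball (ctr x) (δ (ctr x))`, `ctr x ∈ K`, for `x ∈ K`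
  have hctr : ∀ x : ℂ, ∃ c : ℂ, x ∈ K → c ∈ K ∧ Metric.ball x η₀ ⊆ Metric.ball c (δ c) := by
    intro x
    by_cases hx : x ∈ K
    · obtain ⟨i, hi⟩ := hleb x hx
      exact ⟨i.1, fun _ => ⟨i.2, hi⟩⟩
    · exact ⟨0, fun h => absurd h hx⟩
  choose ctr hctr using hctr
  -- the glued family over the wider half-plane `{s - η₀ < re b}`
  refine ⟨η₀, hη₀,
    fun b => if s < b.re then F b else if |b.im| ≤ ε'⁻¹ + 1 then F' (ctr ⟨s, b.im⟩) b else Ffar b,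
    famOn_of_locally fun b₀ hb₀ => ?_⟩
  by_cases h₀ : s < b₀.re
  · -- on the open half-plane the glued map is `F`
    exact ⟨{b : ℂ | s < b.re}, hHopen.mem_nhds h₀, F, {b : ℂ | s < b.re}, Subset.rfl, hF,
      fun b hb => if_pos hb⟩
  push Not at h₀
  by_cases him : |b₀.im| ≤ ε'⁻¹ + 1
  · -- near a point of the middle piece the glued map is the EXT family of the centre of `b₀`
    obtain ⟨hcK, hcball⟩ := hctr _ (show (⟨s, b₀.im⟩ : ℂ) ∈ K from ⟨rfl, him⟩)
    obtain ⟨-, hFam₀, hagree₀⟩ := hδF' _ (hKre _ hcK)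
    have hb₀ball : b₀ ∈ Metric.ball (ctr ⟨s, b₀.im⟩) (δ (ctr ⟨s, b₀.im⟩)) :=
      hcball (mem_ball_foot hb₀ h₀)
    refine ⟨Metric.ball (ctr ⟨s, b₀.im⟩) (δ (ctr ⟨s, b₀.im⟩)) ∩ {b : ℂ | s - η₀ < b.re},
      (Metric.isOpen_ball.inter (isOpen_lt continuous_const Complex.continuous_re)).mem_nhds
        ⟨hb₀ball, hb₀⟩,
      F' (ctr ⟨s, b₀.im⟩), Metric.ball (ctr ⟨s, b₀.im⟩) (δ (ctr ⟨s, b₀.im⟩)), inter_subset_left,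
      hFam₀, ?_⟩
    rintro b ⟨hbball, hbstrip⟩
    by_cases h : s < b.re
    · rw [if_pos h]
      exact (hagree₀ b ⟨h, hbball⟩).symm
    rw [if_neg h]
    push Not at h
    by_cases hbim : |b.im| ≤ ε'⁻¹ + 1
    · rw [if_pos hbim]
      obtain ⟨hcK', hcball'⟩ := hctr _ (show (⟨s, b.im⟩ : ℂ) ∈ K from ⟨rfl, hbim⟩)
      obtain ⟨-, hFam₁, hagree₁⟩ := hδF' _ (hKre _ hcK')
      exact extAgree hUniq hcK'.1 hcK.1 hFam₁ hFam₀ hagree₁ hagree₀ b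
        ⟨hcball' (mem_ball_foot hbstrip h), hbball⟩
    · rw [if_neg hbim]
      push Not at hbim
      exact farAgree hε' hball hFar (hFfar.1 b (hfar_of_im b hbim)) (hFam₀.1 b hbball)
        (hfar_of_im b hbim)
  · -- near a far point the glued map is the far family
    push Not at him
    refine ⟨{b : ℂ | ε'⁻¹ + 1 < |b.im|},
      (isOpen_lt continuous_const (continuous_abs.comp Complex.continuous_im)).mem_nhds him,
      Ffar, {b : ℂ | ε'⁻¹ < ‖b‖}, fun b hb => hfar_of_im b hb, hFfar, fun b hb => ?_⟩
    by_cases h : s < b.re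
    · rw [if_pos h]
      exact farAgree hε' hball hFar (hF.1 b h) (hFfar.1 b (hfar_of_im b hb)) (hfar_of_im b hb)
    · rw [if_neg h, if_neg (not_le.2 hb)]

end Summit.SmoothPoincare4.SmoothPoincare4.Theorems.WitnessCharge.PencilIncompleteness
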